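import Summits.ResolutionOfSingularities.ResolutionOfSingularities.Theorems.HomologicalConductorNoZenoResidualInequality
import HarnessLib

/-!
# Crux `NoZenoR` / `NoZeno` (stmt-ResolutionOfSingularities-19943 / -16483) — LOCAL DEPTH meets the RESIDUAL INEQUALITY
# at a non-principalizing step of an eternal thread

Route `ResolutionOfSingularities/HomologicalConductor`, W4.4 chain, line `thread-composite` r1.7 §4 «THE THIRD CLAUSE, TYPED»
(author res-L0-w44-strat-1 g14, `L/res-L0-w44-strat-1/line-thread-composite-r1.lean` 119c78d9a6dfd65d l.955–1031, sorry-free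
there; res-L0-w44-plan-1 g20 DESK WORD 2/3 (o3′), strat-1 NO OBJECTION + byte pointers 18:42:35Z): the TREE HOME, DEF-FREE, of
the three sorry-free lemmas of §4.  The line's predicates are UNFOLDED, no `Sig.`/`def` enters the tree:

* (T1)_loc `localDepthLE O A P hP V n r` («`𝔪_(D_(n+1))^r ⊆ J_n·D_(n+2)`», the depth measured in the NEXT germ) unfolds to
  `∀ f : Fin r → K, (∀ i, f i ∈ D_(n+1) ∧ V.valuation (f i) < 1) → (∏ i, f i) ∈ Submodule.span ↥D_(n+2) (ca (tower O A (n+1)))`;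
* (T3′) `embDimLE D V M` («`μ(𝔪_D) ≤ M`») unfolds to `∃ S : Finset K, S.card ≤ M ∧ (∀ s ∈ S, s ∈ D ∧ V.valuation s < 1) ∧
  ∀ x (hx : x ∈ D), V.valuation x < 1 → ⟨x, hx⟩ ∈ Ideal.span {s : ↥D | (s : K) ∈ S}`;
* the thread germ `germ O A P hP i` is `Parasite.locPrime (tower O A (i + 1)) (P (i + 1)) (hP (i + 1))` (rfl), as in
  `…NoZenoVmaxCofinal` (p552231) / `…NoZenoResidualInequality` (p553995).

Contents: `germ_le_germ_succ` (the germ chain grows under `hcompat`; thin wrapper of the tree's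
`Thread.locPrime_le_locPrime_succ` in germ indexing) · `embDimLE_mono` · `localDepthLE_succ` (monotonicity of (T1)_loc in the
exponent) · **`valuation_pow_le_of_localDepthLE`** ((T1)_loc at a non-principalizing step ⇒ `V.valuation (z ^ r) ≤ V.valuation y`
for every `V`-non-unit `z` of `D_(n+1)` and every `V`-minimal `y ∈ ca(T_(n+1))` — additively `r·ord_V z ≥ a_n`, in particular
`r·b_n ≥ a_n`; over the tree's (P″) `valuation_pow_le_of_not_principalizes`).  The residual `Sig.CLSupply` of r1.7 is NOT ported
(no source).  Binder order = the line's (drop-in names).  OURS (cell res-hironaka): AI-produced and kernel-checked, weaker than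
expert review; nothing here is a statement of the manuscript under review (Hironaka 2017); fact-free, counted 0.
-/

noncomputable section

-- single-problem summit: the doubled namespace component `ResolutionOfSingularities` is forced
set_option linter.dupNamespace false

namespace Summit.ResolutionOfSingularities.ResolutionOfSingularities.Theorems.NoZeno.CompositeDominator

open IsLocalRing
open Summit.ResolutionOfSingularities.ResolutionOfSingularities.Theses.HomologicalConductor
open Summit.ResolutionOfSingularities.ResolutionOfSingularities.Theorems.NoZeno.Birth
open Summit.ResolutionOfSingularities.ResolutionOfSingularities.Theorems.NoZeno
open Summit.ResolutionOfSingularities.ResolutionOfSingularities.Theorems.NoZeno.ZariskiDescent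
open Literature.AlgebraicGeometry.Resolution

variable {k K : Type} [Field k] [Field K] [Algebra k K]

/-! ## The germ chain grows -/

open Summit.ResolutionOfSingularities.ResolutionOfSingularities.Theorems.NoZeno.SandwichCluster in
/-- Along a compatible thread of primes (`hcompat`) the germ chain grows: `D_(n+1) ≤ D_(n+2)`, i.e. the line's
`germ O A P hP n ≤ germ O A P hP (n + 1)` (res-L0-w44-strat-1 r1.7 §1 `germ_le_germ_succ`; = the tree's
`Thread.locPrime_le_locPrime_succ` in germ indexing). [this work; composition only] -/
theorem germ_le_germ_succ (O : ValuationSubring K) (A : Subalgebra k K) (P : ∀ m : ℕ, Ideal ↥(tower O A m))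
    (hP : ∀ m, (P m).IsPrime)
    (hcompat : ∀ (m : ℕ) (x : K) (hx : x ∈ tower O A m) (hx' : x ∈ tower O A (m + 1)),
      (⟨x, hx'⟩ : ↥(tower O A (m + 1))) ∈ P (m + 1) ↔ (⟨x, hx⟩ : ↥(tower O A m)) ∈ P m)
    (n : ℕ) :
    Parasite.locPrime (tower O A (n + 1)) (P (n + 1)) (hP (n + 1)) ≤
      Parasite.locPrime (tower O A (n + 1 + 1)) (P (n + 1 + 1)) (hP (n + 1 + 1)) := fun _ hx =>
  Thread.locPrime_le_locPrime_succ O A (n + 1) (P (n + 1)) (hP (n + 1)) (P (n + 1 + 1)) (hP (n + 1 + 1))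
    (fun x hx₁ hx₂ h => (hcompat (n + 1) x hx₁ hx₂).mp h) hx

/-! ## (T3′) monotonicity -/

omit [Algebra k K] in
/-- Monotonicity of (T3′) `embDimLE D V M` («`μ(𝔪_D) ≤ M`», UNFOLDED: `M` elements of `D` of positive `V`-order generate the
ideal of all of them) in the bound `M`. (res-L0-w44-strat-1 r1.7 §4 `embDimLE_mono`.) [this work; elementary] -/
theorem embDimLE_mono {D : Subring K} {V : ValuationSubring K} {M M' : ℕ} (h : M ≤ M') :
    (∃ S : Finset K, S.card ≤ M ∧ (∀ s ∈ S, s ∈ D ∧ V.valuation s < 1) ∧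
      ∀ (x : K) (hx : x ∈ D), V.valuation x < 1 →
        (⟨x, hx⟩ : ↥D) ∈ Ideal.span {s : ↥D | (s : K) ∈ (S : Set K)}) →
    ∃ S : Finset K, S.card ≤ M' ∧ (∀ s ∈ S, s ∈ D ∧ V.valuation s < 1) ∧
      ∀ (x : K) (hx : x ∈ D), V.valuation x < 1 →
        (⟨x, hx⟩ : ↥D) ∈ Ideal.span {s : ↥D | (s : K) ∈ (S : Set K)} := by
  rintro ⟨S, hS, hSD, hgen⟩
  exact ⟨S, hS.trans h, hSD, hgen⟩

/-! ## (T1)_loc monotonicity in the exponent -/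

open Summit.ResolutionOfSingularities.ResolutionOfSingularities.Theorems.NoZeno.SandwichCluster in
/-- Monotonicity of (T1)_loc `localDepthLE O A P hP V n r` (UNFOLDED: every product of `r` `V`-non-units of `D_(n+1)` lies in
the `D_(n+2)`-span of `ca(T_(n+1))`, i.e. «`𝔪_(D_(n+1))^r ⊆ J_n·D_(n+2)`») in the exponent: `r ↦ r + 1` (the extra factor
lies in `D_(n+1) ≤ D_(n+2)` by `germ_le_germ_succ`, and the span is a `D_(n+2)`-module).  Needs the germ chain to grow
(`hcompat`). (res-L0-w44-strat-1 r1.7 §4 `localDepthLE_succ`.) [this work; elementary] -/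
theorem localDepthLE_succ (O : ValuationSubring K) (A : Subalgebra k K) (P : ∀ m : ℕ, Ideal ↥(tower O A m))
    (hP : ∀ m, (P m).IsPrime)
    (hcompat : ∀ (m : ℕ) (x : K) (hx : x ∈ tower O A m) (hx' : x ∈ tower O A (m + 1)),
      (⟨x, hx'⟩ : ↥(tower O A (m + 1))) ∈ P (m + 1) ↔ (⟨x, hx⟩ : ↥(tower O A m)) ∈ P m)
    (V : ValuationSubring K) (n r : ℕ)
    (h : ∀ f : Fin r → K,
      (∀ i, f i ∈ Parasite.locPrime (tower O A (n + 1)) (P (n + 1)) (hP (n + 1)) ∧ V.valuation (f i) < 1) →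
        (∏ i, f i) ∈ Submodule.span ↥(Parasite.locPrime (tower O A (n + 1 + 1)) (P (n + 1 + 1)) (hP (n + 1 + 1)))
          (ca (tower O A (n + 1)))) :
    ∀ f : Fin (r + 1) → K,
      (∀ i, f i ∈ Parasite.locPrime (tower O A (n + 1)) (P (n + 1)) (hP (n + 1)) ∧ V.valuation (f i) < 1) →
        (∏ i, f i) ∈ Submodule.span ↥(Parasite.locPrime (tower O A (n + 1 + 1)) (P (n + 1 + 1)) (hP (n + 1 + 1)))
          (ca (tower O A (n + 1))) := by
  intro f hf
  rw [Fin.prod_univ_castSucc]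
  have hprod : (∏ i : Fin r, f (Fin.castSucc i)) ∈
      Submodule.span ↥(Parasite.locPrime (tower O A (n + 1 + 1)) (P (n + 1 + 1)) (hP (n + 1 + 1)))
        (ca (tower O A (n + 1))) :=
    h (fun i => f (Fin.castSucc i)) (fun i => hf (Fin.castSucc i))
  have hlast : f (Fin.last r) ∈ Parasite.locPrime (tower O A (n + 1 + 1)) (P (n + 1 + 1)) (hP (n + 1 + 1)) :=
    germ_le_germ_succ O A P hP hcompat n (hf (Fin.last r)).1
  have := Submodule.smul_mem _
    (⟨f (Fin.last r), hlast⟩ : ↥(Parasite.locPrime (tower O A (n + 1 + 1)) (P (n + 1 + 1)) (hP (n + 1 + 1)))) hprod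
  rw [Algebra.smul_def, mul_comm] at this
  exact this

/-! ## (T1)_loc meets (RI) -/

open Summit.ResolutionOfSingularities.ResolutionOfSingularities.Theorems.NoZeno.SandwichCluster in
/-- **(T1)_loc MEETS (RI)** — the tree's (P″) `valuation_pow_le_of_not_principalizes` fed with the local depth: at a
non-principalizing step `n` (`V` dominating `D_(n+2)`), if `𝔪_(D_(n+1))^(r+1) ⊆ J_n·D_(n+2)` — (T1)_loc `localDepthLE … n (r+1)`,
UNFOLDED: every product of `r + 1` `V`-non-units of `D_(n+1)` lies in the `D_(n+2)`-span of `ca(T_(n+1))` — then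
`V.valuation (z ^ r) ≤ V.valuation y` for every `V`-non-unit `z` of `D_(n+1)` and every `V`-minimal `y ∈ ca(T_(n+1))`;
additively `r·ord_V z ≥ a_n`, in particular `r·b_n ≥ a_n` ((T1)_loc at a non-principalizing step ⇒ the residual inequality);
a uniform (T1)_loc bound `r_n ≤ r + 1` is consistent with the base-point habitat iff `r ≥ a_n/b_n` at every late stage.
(res-L0-w44-strat-1 r1.7 §4 `valuation_pow_le_of_localDepthLE`.) [this work; composition only] -/
theorem valuation_pow_le_of_localDepthLE (O : ValuationSubring K) (A : Subalgebra k K)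
    (hk : ∀ c : k, algebraMap k K c ∈ O) (hA : A.FG) (hfr : IsFractionRing ↥A K)
    (hAO : A.toSubring ≤ O.toSubring)
    (P : ∀ m : ℕ, Ideal ↥(tower O A m)) (hP : ∀ m, (P m).IsPrime) (V : ValuationSubring K) (n : ℕ)
    (hdom : SubringDominates (Parasite.locPrime (tower O A (n + 1 + 1)) (P (n + 1 + 1)) (hP (n + 1 + 1)))
      V.toSubring)
    (hnp : ¬ Zariski.Principalizes
      (fun i => Parasite.locPrime (tower O A (i + 1)) (P (i + 1)) (hP (i + 1))) V n)
    {y : K} (hy : y ∈ ca (tower O A (n + 1))) (hy0 : y ≠ 0)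
    (hvmax : ∀ x ∈ ca (tower O A (n + 1)), V.valuation x ≤ V.valuation y)
    {z : K} (hz : z ∈ Parasite.locPrime (tower O A (n + 1)) (P (n + 1)) (hP (n + 1))) (hvz : V.valuation z < 1)
    {r : ℕ}
    (hdepth : ∀ f : Fin (r + 1) → K,
      (∀ i, f i ∈ Parasite.locPrime (tower O A (n + 1)) (P (n + 1)) (hP (n + 1)) ∧ V.valuation (f i) < 1) →
        (∏ i, f i) ∈ Submodule.span ↥(Parasite.locPrime (tower O A (n + 1 + 1)) (P (n + 1 + 1)) (hP (n + 1 + 1)))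
          (ca (tower O A (n + 1)))) :
    V.valuation (z ^ r) ≤ V.valuation y := by
  refine valuation_pow_le_of_not_principalizes O A hk hA hfr hAO P hP V n hdom hnp hy hy0 hvmax ?_
  intro x hx hvx
  have h := hdepth (Fin.snoc (fun _ : Fin r => z) x) (fun i => ?_)
  · simpa [Fin.prod_univ_castSucc, Fin.snoc_castSucc, Fin.snoc_last, Finset.prod_const, Finset.card_univ,
      Fintype.card_fin] using h
  · refine Fin.lastCases ?_ (fun j => ?_) i
    · simpa [Fin.snoc_last] using And.intro hx hvx
    · simpa [Fin.snoc_castSucc] using And.intro hz hvz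

end Summit.ResolutionOfSingularities.ResolutionOfSingularities.Theorems.NoZeno.CompositeDominator

end
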